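import Literature.MathematicalPhysics.QuantumManyBody.TorusGalerkinScattering
import Literature.MathematicalPhysics.QuantumManyBody.DiluteBoseGasBogoliubovAngles
import Literature.MathematicalPhysics.QuantumManyBody.BogoliubovWeylTrialFunctional
import Literature.MathematicalPhysics.QuantumManyBody.CubicTrialVector
import Mathlib.Data.Prod.Lex
import Mathlib.Order.Fin.Tuple
import HarnessLib

/-!
# The Bogoliubov–Weyl–cubic trial state of Basti–Cenatiempo–Schlein on a finite momentum box

Topic `Literature/MathematicalPhysics/QuantumManyBody`, namespace `BoseGas.BCSTrial`; the concrete
choices (definitions with bodies) of the trial state `W(N₀)T_νξ_ν/‖ξ_ν‖` of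
[BastiCenatiempoSchlein2021, (2.9)–(2.13)] in the finite-mode holomorphic Fock model of this
library, at the exponents `γ = 11/10` (`L = ρ^{-11/10}`), `κ = 12/23`, `ε = 1/23` used by the
provefact `Literature.MathematicalPhysics.QuantumManyBody.BoseGas.BastiCenatiempoSchlein2021_upperBound`.

* **Modes** `ModeBox M = Fin 3 → Fin (2M+1)` with momentum labels `e n = n - M ∈ ℤ³` (injective),
  the involution `σ n = 2M - n` (`e ∘ σ = -e`), the condensate `z = (M,M,M)` (`e z = 0`), the
  lexicographic linear order (for orienting triples) and the half space `P = {p : z < p}` of pair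
  representatives (`σ` reverses the order, so `p ∈ P ⇒ σp ∉ P`);
* **scales** as functions of the density `ρ`: `L = ρ^{-11/10}`, `N = ρL³`, the box size
  `M = ⌈ρ^{-3}⌉₊`, and the sets `P_L = {0 < |n|² ≤ ρ^{-7/5}}`, `P_S = {ρ^{-11/10} ≤ |n|² ≤ ρ^{-7/5}}`,
  `P_H = {ρ^{-2} < |n|²}` (i.e. `|p| ≤ N^{κ/2+ε}`, `N^{κ/2-ε/2} ≤ |p| ≤ N^{κ/2+ε}`, `|p| > N^{1-κ-ε}`
  in the units of [ibid., (2.8)]);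
* **data**: `ε_p = |2πe(p)/L|²`, `W = Re W_L` (`W_L = potFT v L`), the even Galerkin scattering
  amplitudes `c` on the nonzero modes (`galerkinMin`, chosen by `Classical.epsilon` from
  `exists_even_minimiser`), `ĝ₀ = W(0) - ∑W(e q)c_q`, `g = ρĝ₀`, `η = -Nc`;
* **Bogoliubov angles** `t_p = bogTanh g ε_p` on `P_L` and `t_p = clip η_p` elsewhere
  (`clip` to `[-1/2, 1/2]`; no clipping occurs in the regime), `S = ∑σ_p²`, `N₀ = N - S`;
* **the cubic vector** `ξ = cubicVector e P_H P_S κ`, `κ_τ = (η_u + η_a)σ_b/√N`, and the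
  **sector weights** `weight n = trialWeight z σ P N₀ t ξ n` of the normalised trial state.

## References

* [BastiCenatiempoSchlein2021] G. Basti, S. Cenatiempo, B. Schlein, Forum Math. Sigma 9 (2021) e74,
  arXiv:2101.06222: (2.3)–(2.5), (2.8)–(2.13), Prop. 1.3.
-/

noncomputable section

namespace Literature.MathematicalPhysics.QuantumManyBody.BoseGas

open Complex MvPolynomial Finset MeasureTheory
open scoped ComplexConjugate BigOperators ENNReal

namespace BCSTrial

/-! ### The momentum box -/

/-- The **momentum box** of half-width `M`: modes `n ∈ {0,…,2M}³`, labelling the momenta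
`n - (M,M,M) ∈ [-M, M]³ ⊂ ℤ³`. [cite: BastiCenatiempoSchlein2021, (2.1) (`Λ* = 2πℤ³`, here truncated)] -/
def ModeBox (M : ℕ) : Type := Fin 3 → Fin (2 * M + 1)

variable {M : ℕ}

/-- Finitely many modes in the box. [folklore] -/
instance instFintype (M : ℕ) : Fintype (ModeBox M) := inferInstanceAs (Fintype (Fin 3 → Fin (2 * M + 1)))

/-- The momentum label `e n = n - M ∈ ℤ³`. [cite: BastiCenatiempoSchlein2021, (2.1)] -/
def e (M : ℕ) (n : ModeBox M) : Momentum := fun j => ((n j : ℕ) : ℤ) - M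

/-- The condensate mode `z = (M, M, M)`, `e z = 0`. [cite: BastiCenatiempoSchlein2021, (2.2)] -/
def z (M : ℕ) : ModeBox M := fun _ => ⟨M, by omega⟩

/-- The pairing involution `σ n = 2M - n`, `e (σ n) = -e n`. [cite: BastiCenatiempoSchlein2021, (2.10)] -/
def neg (M : ℕ) (n : ModeBox M) : ModeBox M := fun j => ⟨2 * M - (n j : ℕ), by omega⟩

/-- The momentum labels are injective. [folklore] -/
theorem e_injective (M : ℕ) : Function.Injective (e M) := by
  intro n m h
  funext j
  have hj := congrFun h j
  simp only [e] at hj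
  exact Fin.ext (by exact_mod_cast (sub_left_inj.1 hj))

/-- `e z = 0`. [folklore] -/
theorem e_z (M : ℕ) : e M (z M) = 0 := by
  funext j; simp [e, z]

/-- `e (σ n) = -e n`. [folklore] -/
theorem e_neg (M : ℕ) (n : ModeBox M) : e M (neg M n) = -e M n := by
  funext j
  have h := (n j).isLt
  simp only [e, neg, Pi.neg_apply]
  push_cast [Nat.cast_sub (by omega : (n j : ℕ) ≤ 2 * M)]
  ring

/-- `σ` is an involution. [folklore] -/
theorem neg_neg (M : ℕ) (n : ModeBox M) : neg M (neg M n) = n := by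
  funext j
  have h := (n j).isLt
  apply Fin.ext
  simp only [neg]
  omega

/-- `σ` is an involution. [folklore] -/
theorem neg_involutive (M : ℕ) : Function.Involutive (neg M) := neg_neg M

/-- `σ z = z`. [folklore] -/
theorem neg_z (M : ℕ) : neg M (z M) = z M := by
  funext j; apply Fin.ext; simp [neg, z]; omega

/-- Only the condensate has momentum `0`. [folklore] -/
theorem e_eq_zero_iff (M : ℕ) (n : ModeBox M) : e M n = 0 ↔ n = z M := by
  constructor
  · intro h; exact e_injective M (h.trans (e_z M).symm)
  · rintro rfl; exact e_z M

/-- The **lexicographic order** on the box (to orient triples). [folklore] -/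
instance instLinearOrder (M : ℕ) : LinearOrder (ModeBox M) :=
  LinearOrder.lift' (fun n : ModeBox M => toLex (n 0, toLex (n 1, n 2)))
    (by
      intro n m h
      simp only [toLex_inj, Prod.mk.injEq] at h
      funext j
      fin_cases j
      · exact h.1
      · exact h.2.1
      · exact h.2.2)

/-- The order is the lexicographic one. [folklore] -/
theorem lt_def (n m : ModeBox M) : n < m ↔ toLex (n 0, toLex (n 1, n 2)) < toLex (m 0, toLex (m 1, m 2)) :=
  Iff.rfl

/-- Coordinate reversal on `Fin (2M+1)` is strictly antitone. [folklore] -/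
theorem neg_apply_lt_iff (n m : ModeBox M) (j : Fin 3) : neg M n j < neg M m j ↔ m j < n j := by
  have hn := (n j).isLt; have hm := (m j).isLt
  simp only [neg, Fin.lt_def]
  omega

/-- Coordinate reversal is injective. [folklore] -/
theorem neg_apply_eq_iff (n m : ModeBox M) (j : Fin 3) : neg M n j = neg M m j ↔ n j = m j := by
  constructor
  · intro h
    have := congrFun (congrArg (neg M) (show neg M n = neg M n from rfl)) j
    have h' := congrArg (fun x : Fin (2 * M + 1) => (x : ℕ)) h
    have hn := (n j).isLt; have hm := (m j).isLt
    simp only [neg] at h'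
    exact Fin.ext (by omega)
  · intro h; simp only [neg, h]

/-- **`σ` reverses the lexicographic order.** [folklore] -/
theorem neg_lt_neg_iff (n m : ModeBox M) : neg M n < neg M m ↔ m < n := by
  simp only [lt_def, Prod.Lex.toLex_lt_toLex, neg_apply_lt_iff, neg_apply_eq_iff]
  constructor
  · rintro (h | ⟨h0, h | ⟨h1, h2⟩⟩)
    · exact Or.inl h
    · exact Or.inr ⟨h0.symm, Or.inl h⟩
    · exact Or.inr ⟨h0.symm, Or.inr ⟨h1.symm, h2⟩⟩
  · rintro (h | ⟨h0, h | ⟨h1, h2⟩⟩)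
    · exact Or.inl h
    · exact Or.inr ⟨h0.symm, Or.inl h⟩
    · exact Or.inr ⟨h0.symm, Or.inr ⟨h1.symm, h2⟩⟩

/-- The **half space of pair representatives**: `P = {p : z < p}`. [cite: BastiCenatiempoSchlein2021, (2.10) (`Λ*₊`)] -/
def halfSpace (M : ℕ) : Finset (ModeBox M) := Finset.univ.filter fun p => z M < p

/-- Membership in the half space. [folklore] -/
theorem mem_halfSpace {p : ModeBox M} : p ∈ halfSpace M ↔ z M < p := by
  simp [halfSpace]

/-- `p ∈ P ⇒ σp ∉ P`. [cite: BastiCenatiempoSchlein2021, (2.10)] -/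
theorem neg_not_mem_halfSpace {p : ModeBox M} (hp : p ∈ halfSpace M) : neg M p ∉ halfSpace M := by
  rw [mem_halfSpace] at hp ⊢
  intro h
  rw [← neg_z M, neg_lt_neg_iff] at h
  exact lt_asymm hp h

/-- Every nonzero mode is represented: `p ≠ z ⇒ p ∈ P ∨ σp ∈ P`. [cite: BastiCenatiempoSchlein2021, (2.10)] -/
theorem mem_halfSpace_or {p : ModeBox M} (hp : p ≠ z M) : p ∈ halfSpace M ∨ neg M p ∈ halfSpace M := by
  rw [mem_halfSpace, mem_halfSpace, ← neg_z M, neg_lt_neg_iff, neg_z]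
  rcases lt_trichotomy (z M) p with h | h | h
  · exact Or.inl h
  · exact absurd h.symm hp
  · exact Or.inr h

/-- The condensate is not a pair representative. [folklore] -/
theorem z_not_mem_halfSpace : z M ∉ halfSpace M := by
  rw [mem_halfSpace]; exact lt_irrefl _

/-! ### Scales and momentum sets as functions of the density -/

/-- `L = ρ^{-11/10}`. [cite: BastiCenatiempoSchlein2021, Prop. 1.3 (`L = ρ̃^{-γ}`, `γ = 11/10`)] -/
def boxSide (ρ : ℝ) : ℝ := ρ ^ (-(11 : ℝ) / 10)

/-- `N = ρL³`. [cite: BastiCenatiempoSchlein2021, Prop. 1.3] -/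
def particleNumber (ρ : ℝ) : ℝ := ρ * boxSide ρ ^ 3

/-- The half-width of the momentum box, `M = ⌈ρ^{-9/5}⌉₊`: above the approximation scale
`L·ρ^{-3/5} = ρ^{-17/10}` needed for the band-limited comparison function of the Galerkin energy
(`ĝ₀ ≤ 8π𝔞(1 + Cρ^{3/5})`, cf. Lemma 2.1 (ii)), and below `ρ^{-37/20}`, where the `ℓ¹`-type sums
`∑_{P_H}|η| ≤ Cρ^{-6/5}M` entering the cutoff errors of the hard block would exceed the precision
`ρ^{5/2+1/10}L³` of Prop. 1.3. [cite: BastiCenatiempoSchlein2021, Prop. 1.3, Lemma 2.1 (ii), §5.3] -/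
def boxSize (ρ : ℝ) : ℕ := ⌈ρ ^ (-(9 : ℝ) / 5)⌉₊

/-- `|n|²` of a momentum label. [folklore] -/
def nsq (n : Momentum) : ℝ := ∑ j, ((n j : ℤ) : ℝ) ^ 2

/-- The kinetic energy `ε_p = |2πe(p)/L|²`. [cite: BastiCenatiempoSchlein2021, (2.1)] -/
def eps (ρ : ℝ) (p : ModeBox (boxSize ρ)) : ℝ := ‖waveVector (boxSide ρ) (e (boxSize ρ) p)‖ ^ 2

/-- `P_L = {0 < |n|² ≤ ρ^{-7/5}}` (`|p| ≤ N^{κ/2+ε}`). [cite: BastiCenatiempoSchlein2021, (2.9)] -/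
def lowSet (ρ : ℝ) : Finset (ModeBox (boxSize ρ)) :=
  Finset.univ.filter fun p => 0 < nsq (e (boxSize ρ) p) ∧ nsq (e (boxSize ρ) p) ≤ ρ ^ (-(7 : ℝ) / 5)

/-- `P_S = {ρ^{-11/10} ≤ |n|² ≤ ρ^{-7/5}}` (`N^{κ/2-ε/2} ≤ |p| ≤ N^{κ/2+ε}`).
[cite: BastiCenatiempoSchlein2021, (2.8)] -/
def softSet (ρ : ℝ) : Finset (ModeBox (boxSize ρ)) :=
  Finset.univ.filter fun p => ρ ^ (-(11 : ℝ) / 10) ≤ nsq (e (boxSize ρ) p) ∧ nsq (e (boxSize ρ) p) ≤ ρ ^ (-(7 : ℝ) / 5)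

/-- `P_H = {ρ^{-2} < |n|²}` (`|p| > N^{1-κ-ε}`). [cite: BastiCenatiempoSchlein2021, (2.8)] -/
def hardSet (ρ : ℝ) : Finset (ModeBox (boxSize ρ)) :=
  Finset.univ.filter fun p => ρ ^ (-(2 : ℝ)) < nsq (e (boxSize ρ) p)

/-- `|n|²` is even. [folklore] -/
theorem nsq_neg (n : Momentum) : nsq (-n) = nsq n := by
  simp [nsq]

/-- `|n|² ≥ 0`. [folklore] -/
theorem nsq_nonneg (n : Momentum) : 0 ≤ nsq n := Finset.sum_nonneg fun _ _ => sq_nonneg _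

/-- `|n|² = 0 ↔ n = 0`. [folklore] -/
theorem nsq_eq_zero_iff (n : Momentum) : nsq n = 0 ↔ n = 0 := by
  constructor
  · intro h
    funext j
    have hj : ((n j : ℤ) : ℝ) ^ 2 = 0 := by
      have := (Finset.sum_eq_zero_iff_of_nonneg (fun i _ => sq_nonneg ((n i : ℤ) : ℝ))).1 h j (Finset.mem_univ j)
      exact this
    exact_mod_cast pow_eq_zero_iff (n := 2) (by norm_num) |>.1 hj
  · rintro rfl; simp [nsq]

/-- `|n|² ≥ 1` for `n ≠ 0`. [folklore] -/
theorem one_le_nsq {n : Momentum} (hn : n ≠ 0) : 1 ≤ nsq n := by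
  obtain ⟨j, hj⟩ : ∃ j, n j ≠ 0 := by
    by_contra h; push Not at h; exact hn (funext h)
  have h1 : (1 : ℝ) ≤ ((n j : ℤ) : ℝ) ^ 2 := by
    have : (1 : ℤ) ≤ (n j) ^ 2 := by nlinarith [Int.one_le_abs hj, sq_abs (n j)]
    exact_mod_cast this
  exact h1.trans (Finset.single_le_sum (f := fun j => ((n j : ℤ) : ℝ) ^ 2) (fun j _ => sq_nonneg _) (Finset.mem_univ j))

/-- Membership in `P_L`. [folklore] -/
theorem mem_lowSet {ρ : ℝ} {p : ModeBox (boxSize ρ)} :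
    p ∈ lowSet ρ ↔ 0 < nsq (e _ p) ∧ nsq (e _ p) ≤ ρ ^ (-(7 : ℝ) / 5) := by simp [lowSet]

/-- Membership in `P_S`. [folklore] -/
theorem mem_softSet {ρ : ℝ} {p : ModeBox (boxSize ρ)} :
    p ∈ softSet ρ ↔ ρ ^ (-(11 : ℝ) / 10) ≤ nsq (e _ p) ∧ nsq (e _ p) ≤ ρ ^ (-(7 : ℝ) / 5) := by simp [softSet]

/-- Membership in `P_H`. [folklore] -/
theorem mem_hardSet {ρ : ℝ} {p : ModeBox (boxSize ρ)} :
    p ∈ hardSet ρ ↔ ρ ^ (-(2 : ℝ)) < nsq (e _ p) := by simp [hardSet]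

/-- `P_L` is symmetric. [folklore] -/
theorem neg_mem_lowSet_iff {ρ : ℝ} {p : ModeBox (boxSize ρ)} : neg _ p ∈ lowSet ρ ↔ p ∈ lowSet ρ := by
  rw [mem_lowSet, mem_lowSet, e_neg, nsq_neg]

/-- `P_S` is symmetric. [folklore] -/
theorem neg_mem_softSet_iff {ρ : ℝ} {p : ModeBox (boxSize ρ)} : neg _ p ∈ softSet ρ ↔ p ∈ softSet ρ := by
  rw [mem_softSet, mem_softSet, e_neg, nsq_neg]

/-- `P_H` is symmetric. [folklore] -/
theorem neg_mem_hardSet_iff {ρ : ℝ} {p : ModeBox (boxSize ρ)} : neg _ p ∈ hardSet ρ ↔ p ∈ hardSet ρ := by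
  rw [mem_hardSet, mem_hardSet, e_neg, nsq_neg]

/-- `z ∉ P_L`. [folklore] -/
theorem z_not_mem_lowSet {ρ : ℝ} : z _ ∉ lowSet ρ := by
  rw [mem_lowSet, e_z]; simp [nsq]

/-- `P_S ⊆ P_L`. [cite: BastiCenatiempoSchlein2021, after (2.8) ("Notice that `P_S ⊂ P_L`")] -/
theorem softSet_subset_lowSet {ρ : ℝ} (hρ : 0 < ρ) : softSet ρ ⊆ lowSet ρ := by
  intro p hp
  rw [mem_softSet] at hp
  rw [mem_lowSet]
  exact ⟨lt_of_lt_of_le (Real.rpow_pos_of_pos hρ _) hp.1, hp.2⟩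

/-- `P_H ∩ P_S = ∅` for `ρ ≤ 1`. [cite: BastiCenatiempoSchlein2021, after (2.8) (`P_H ∩ P_L = ∅`)] -/
theorem disjoint_hardSet_softSet {ρ : ℝ} (hρ : 0 < ρ) (hρ1 : ρ ≤ 1) : Disjoint (hardSet ρ) (softSet ρ) := by
  rw [Finset.disjoint_left]
  intro p hH hS
  rw [mem_hardSet] at hH
  rw [mem_softSet] at hS
  have h : ρ ^ (-(7 : ℝ) / 5) ≤ ρ ^ (-(2 : ℝ)) :=
    Real.rpow_le_rpow_of_exponent_ge hρ hρ1 (by norm_num)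
  linarith [hS.2]

/-- `P_H ∩ P_L = ∅` for `ρ ≤ 1`. [cite: BastiCenatiempoSchlein2021, after (2.8)] -/
theorem disjoint_hardSet_lowSet {ρ : ℝ} (hρ : 0 < ρ) (hρ1 : ρ ≤ 1) : Disjoint (hardSet ρ) (lowSet ρ) := by
  rw [Finset.disjoint_left]
  intro p hH hL
  rw [mem_hardSet] at hH
  rw [mem_lowSet] at hL
  have h : ρ ^ (-(7 : ℝ) / 5) ≤ ρ ^ (-(2 : ℝ)) :=
    Real.rpow_le_rpow_of_exponent_ge hρ hρ1 (by norm_num)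
  linarith [hL.2]

/-- `z ∉ P_H`. [folklore] -/
theorem z_not_mem_hardSet {ρ : ℝ} (hρ : 0 < ρ) : z _ ∉ hardSet ρ := by
  rw [mem_hardSet, e_z]
  simp only [nsq, Pi.zero_apply, Int.cast_zero, ne_eq, OfNat.ofNat_ne_zero, not_false_eq_true, zero_pow,
    Finset.sum_const_zero, not_lt]
  exact (Real.rpow_pos_of_pos hρ _).le

/-- `z ∉ P_S`. [folklore] -/
theorem z_not_mem_softSet {ρ : ℝ} (hρ : 0 < ρ) : z _ ∉ softSet ρ := fun h =>
  z_not_mem_lowSet (softSet_subset_lowSet hρ h)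

/-- The kinetic energy explicitly: `ε_p = 4π²|n|²/L²`. [cite: LSSY2005, App. A (A.6)] -/
theorem eps_eq {ρ : ℝ} (p : ModeBox (boxSize ρ)) : eps ρ p = 4 * Real.pi ^ 2 * nsq (e _ p) / boxSide ρ ^ 2 := by
  rw [eps, norm_waveVector_sq]; rfl

/-- `ε` is even. [folklore] -/
theorem eps_neg {ρ : ℝ} (p : ModeBox (boxSize ρ)) : eps ρ (neg _ p) = eps ρ p := by
  rw [eps_eq, eps_eq, e_neg, nsq_neg]

/-- `ε_z = 0`. [folklore] -/
theorem eps_z {ρ : ℝ} : eps ρ (z _) = 0 := by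
  rw [eps, e_z, waveVector_zero, norm_zero]; norm_num

/-- `ε ≥ 0`. [folklore] -/
theorem eps_nonneg {ρ : ℝ} (p : ModeBox (boxSize ρ)) : 0 ≤ eps ρ p := sq_nonneg _

/-- `L > 0`. [folklore] -/
theorem boxSide_pos {ρ : ℝ} (hρ : 0 < ρ) : 0 < boxSide ρ := Real.rpow_pos_of_pos hρ _

/-- `N > 0`. [folklore] -/
theorem particleNumber_pos {ρ : ℝ} (hρ : 0 < ρ) : 0 < particleNumber ρ :=
  mul_pos hρ (pow_pos (boxSide_pos hρ) 3)

/-- `ε_p ≥ 4π²/L² > 0` off the condensate. [folklore] -/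
theorem eps_pos {ρ : ℝ} (hρ : 0 < ρ) {p : ModeBox (boxSize ρ)} (hp : p ≠ z _) :
    4 * Real.pi ^ 2 / boxSide ρ ^ 2 ≤ eps ρ p := by
  rw [eps_eq]
  have h1 := one_le_nsq (fun h => hp ((e_eq_zero_iff _ p).1 h))
  have hL := boxSide_pos hρ
  rw [div_le_div_iff₀ (by positivity) (by positivity)]
  have h2 : 0 < 4 * Real.pi ^ 2 * boxSide ρ ^ 2 := by positivity
  nlinarith [h2, h1]

/-! ### The pair potential and the Galerkin scattering data -/

/-- `W(k) = Re W_L(k)`, `W_L = potFT v L`. [cite: BastiCenatiempoSchlein2021, (2.1) (`V̂`)] -/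
def W (v : ℝ → ℝ≥0∞) (ρ : ℝ) (k : Momentum) : ℝ := (potFT v (boxSide ρ) k).re

/-- `W` is even. [folklore] -/
theorem W_neg (v : ℝ → ℝ≥0∞) (ρ : ℝ) (k : Momentum) : W v ρ (-k) = W v ρ k := re_potFT_neg v _ k

/-- The nonzero modes (the Galerkin band). [folklore] -/
abbrev Band (ρ : ℝ) : Type := {p : ModeBox (boxSize ρ) // p ≠ z (boxSize ρ)}

/-- The involution restricted to the band. [folklore] -/
def negBand (ρ : ℝ) : Band ρ ≃ Band ρ where
  toFun p := ⟨neg _ p.1, fun h => p.2 (by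
    have := congrArg (neg (boxSize ρ)) h
    rwa [neg_neg, neg_z] at this)⟩
  invFun p := ⟨neg _ p.1, fun h => p.2 (by
    have := congrArg (neg (boxSize ρ)) h
    rwa [neg_neg, neg_z] at this)⟩
  left_inv p := Subtype.ext (neg_neg _ _)
  right_inv p := Subtype.ext (neg_neg _ _)

/-- **The even Galerkin scattering amplitudes** `c` on the band: a minimiser of
`E(c) = ∑ε_pc_p² + (2L³)⁻¹[W(0) - 2∑W(e q)c_q + ∑∑W(e p-e q)c_pc_q]`, even and satisfying the
scattering equation `2L³ε_pc_p = W(e p) - ∑_qW(e p-e q)c_q` (chosen by `Classical.epsilon`; the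
properties hold whenever `exists_even_minimiser` applies). [cite: BastiCenatiempoSchlein2021, (2.3)–(2.5)] -/
def galerkinMin (v : ℝ → ℝ≥0∞) (ρ : ℝ) : Band ρ → ℝ :=
  Classical.epsilon fun c : Band ρ → ℝ =>
    (∀ c', galerkinEnergy (fun p : Band ρ => e _ p.1) (fun p => eps ρ p.1) (W v ρ) (boxSide ρ) c ≤
        galerkinEnergy (fun p : Band ρ => e _ p.1) (fun p => eps ρ p.1) (W v ρ) (boxSide ρ) c') ∧
      (∀ p, c (negBand ρ p) = c p) ∧
      ∀ p, 2 * boxSide ρ ^ 3 * eps ρ p.1 * c p = W v ρ (e _ p.1) - ∑ q, W v ρ (e _ p.1 - e _ q.1) * c q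

/-- **The defining properties of the Galerkin amplitudes** (for an integrable measurable potential
and `ρ > 0`): minimality, evenness, and the exact scattering equation on every nonzero mode.
[cite: BastiCenatiempoSchlein2021, (2.3)–(2.5), Lemma 2.1] -/
theorem galerkinMin_spec {v : ℝ → ℝ≥0∞} (hv : Measurable v) (hint : (∫⁻ x : Space, v ‖x‖) ≠ ⊤) {ρ : ℝ} (hρ : 0 < ρ) :
    (∀ c', galerkinEnergy (fun p : Band ρ => e _ p.1) (fun p => eps ρ p.1) (W v ρ) (boxSide ρ) (galerkinMin v ρ) ≤
        galerkinEnergy (fun p : Band ρ => e _ p.1) (fun p => eps ρ p.1) (W v ρ) (boxSide ρ) c') ∧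
      (∀ p, galerkinMin v ρ (negBand ρ p) = galerkinMin v ρ p) ∧
      ∀ p : Band ρ, 2 * boxSide ρ ^ 3 * eps ρ p.1 * galerkinMin v ρ p =
        W v ρ (e _ p.1) - ∑ q, W v ρ (e _ p.1 - e _ q.1) * galerkinMin v ρ q := by
  have hL := boxSide_pos hρ
  have hm0 : 0 < 4 * Real.pi ^ 2 / boxSide ρ ^ 2 := by positivity
  have hex := exists_even_minimiser (ι := Band ρ) (e := fun p : Band ρ => e _ p.1) (ε := fun p => eps ρ p.1)
    (W := W v ρ) hL hm0 (fun p => eps_pos hρ p.2)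
    (fun c => galerkinPot_re_potFT_nonneg hv hint (boxSide ρ) (fun p : Band ρ => e _ p.1) c)
    (fun c => sum_sum_re_potFT_mul_mul_nonneg hv hint (boxSide ρ) (fun p : Band ρ => e _ p.1) c)
    (negBand ρ) (fun p => Subtype.ext (neg_neg _ _)) (fun p => e_neg _ p.1) (fun p => eps_neg p.1) (W_neg v ρ)
  exact Classical.epsilon_spec hex

/-- The amplitudes extended by `0` to the condensate mode. [folklore] -/
def cExt (v : ℝ → ℝ≥0∞) (ρ : ℝ) (p : ModeBox (boxSize ρ)) : ℝ :=
  if h : p = z (boxSize ρ) then 0 else galerkinMin v ρ ⟨p, h⟩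

/-- **`ĝ₀ = W(0) - ∑_q W(e q)c_q`** (`= 2L³E(c)`, the finite-volume `∫Vf`).
[cite: BastiCenatiempoSchlein2021, Lemma 2.1 (ii), (eq:Vastf)] -/
def gHat0 (v : ℝ → ℝ≥0∞) (ρ : ℝ) : ℝ := W v ρ 0 - ∑ q, W v ρ (e _ q) * cExt v ρ q

/-- **`g = ρĝ₀`** (the role of `8π𝔞N^κ` in [ibid.], with the Galerkin value). [cite: BastiCenatiempoSchlein2021, (2.10)] -/
def gCoupling (v : ℝ → ℝ≥0∞) (ρ : ℝ) : ℝ := ρ * gHat0 v ρ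

/-- **`η = -Nc`**. [cite: BastiCenatiempoSchlein2021, (2.3) (`η_p = -Nŵ(p)`)] -/
def eta (v : ℝ → ℝ≥0∞) (ρ : ℝ) (p : ModeBox (boxSize ρ)) : ℝ := -(particleNumber ρ) * cExt v ρ p

/-! ### The Bogoliubov angles, `N₀`, the cubic vector and the sector weights -/

/-- Clipping to `[-1/2, 1/2]` (inactive in the regime, makes `|t| < 1` unconditional). [folklore] -/
def clip (x : ℝ) : ℝ := max (-(1 / 2 : ℝ)) (min (1 / 2) x)

/-- `|clip x| ≤ 1/2`. [folklore] -/
theorem abs_clip_le (x : ℝ) : |clip x| ≤ 1 / 2 := by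
  unfold clip
  rw [abs_le]
  constructor
  · exact le_max_left _ _
  · exact max_le (by norm_num) (min_le_left _ _)

/-- No clipping for `|x| ≤ 1/2`. [folklore] -/
theorem clip_of_abs_le {x : ℝ} (h : |x| ≤ 1 / 2) : clip x = x := by
  rw [abs_le] at h
  unfold clip
  rw [min_eq_right h.2, max_eq_right h.1]

/-- **The pair amplitudes** `t_p = tanh ν_p`: `bogTanh g ε_p` on `P_L` (diagonalising the
low-momentum quadratic Hamiltonian), `η_p` (clipped) elsewhere. [cite: BastiCenatiempoSchlein2021, (2.9)–(2.10)] -/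
def tAmp (v : ℝ → ℝ≥0∞) (ρ : ℝ) (p : ModeBox (boxSize ρ)) : ℝ :=
  if p ∈ lowSet ρ then bogTanh (gCoupling v ρ) (eps ρ p) else clip (eta v ρ p)

/-- **`S = ∑_p σ_p²`** (the expected number of excited pairs' particles). [cite: BastiCenatiempoSchlein2021, (2.11) (`‖σ_L‖²`)] -/
def depletion (v : ℝ → ℝ≥0∞) (ρ : ℝ) : ℝ :=
  ∑ p, Fock.bogSigma (neg _) (halfSpace _) (tAmp v ρ) p ^ 2

/-- **`N₀ = N - S`**. [cite: BastiCenatiempoSchlein2021, (eq:fixN0) (`N₀ = N - ‖σ_L‖²`)] -/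
def condensate (v : ℝ → ℝ≥0∞) (ρ : ℝ) : ℝ := particleNumber ρ - depletion v ρ

/-- **The cubic amplitudes** `κ_τ = (η_u + η_a)σ_b/√N`. [cite: BastiCenatiempoSchlein2021, (2.12)] -/
def kappa (v : ℝ → ℝ≥0∞) (ρ : ℝ) (τ : Fock.Triple (e (boxSize ρ)) (hardSet ρ) (softSet ρ)) : ℂ :=
  (((eta v ρ τ.u + eta v ρ τ.a) * Fock.bogSigma (neg _) (halfSpace _) (tAmp v ρ) τ.b /
    Real.sqrt (particleNumber ρ) : ℝ) : ℂ)

/-- **The cubic vector** `ξ_ν`. [cite: BastiCenatiempoSchlein2021, (2.12)–(2.13)] -/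
def xi (v : ℝ → ℝ≥0∞) (ρ : ℝ) : MvPolynomial (ModeBox (boxSize ρ)) ℂ :=
  Fock.cubicVector (e (boxSize ρ)) (hardSet ρ) (softSet ρ) (kappa v ρ)

/-- **The sector weights of the trial state** `Ψ = W(N₀)T_νξ_ν/‖ξ_ν‖`. [cite: BastiCenatiempoSchlein2021, Prop. 1.3, (2.9)–(2.13)] -/
def weight (v : ℝ → ℝ≥0∞) (ρ : ℝ) (n : ℕ) : ℝ≥0∞ :=
  Fock.trialWeight (z _) (neg _) (halfSpace _) (condensate v ρ) (tAmp v ρ) (xi v ρ) n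

end BCSTrial

end Literature.MathematicalPhysics.QuantumManyBody.BoseGas

end
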